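import Summits.CriticalPhenomena.PercolationContinuityZ3.Theorems.PercNearOneGluingNoHeavyQuantTopFlippedLightSharpFloorPoly
import HarnessLib

/-!
# QUANT lane R8, T-DEC, binder (II): the TOP-FLIPPED LIGHT PIECES at the SHARP FLOOR `x³ + x² + 3x ≥ 1` — part 2b, the light–light
# capacity inequality cell by cell on the slab `x* ≤ x ≤ 1/3`

builds on p205010 (kernel theorem, internal audit signed; external expert review pending)

Support file (`--supports stmt-CriticalPhenomena-4575`), QUANT lane seat prim-quant-arm-2 (gen 32).  `tfpCellS_*`: as arm-2 g31's
`tfpCellF_*` (`…TopFlippedLightFloorCellsLL`) with the floor hypothesis `1/3 ≤ x` replaced by the slab `1 ≤ x³ + x² + 3x`, `x ≤ 1/3`;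
the cells touching the tight configuration (`LL_1L`, and `LL_HL` through `tfpPolyS_LL_HL`) take their polynomial inequality from the split
certificates of part 1; `LL_1H`, `LL_11` use the aspect-free, floor-free certificates of `…TopFlippedLightLightPoly`.  Theorems only.

[this work]; DEC rules ARCH-TREES-G49 §2.2 / DEC-TAMP-G50 §3.1, the single-low criterion `…QuantSingleLowCapacity` (typer g23), the
cell-certificate pipeline FOR-PROVERS-CERT-PIPELINE (typer g23), the (II) piece anatomy FOR-PROVERS-CONV-PIECES (lead g26) — this lane.
Nothing here is cited as a published result.  The gluing rows served [cite: KozmaNitzan2024, Conjecture 3 (p. 15)]; product measure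
[cite: Grimmett1999, §1.3 p. 10].
-/

noncomputable section

namespace Summit.CriticalPhenomena.PercolationContinuityZ3.Theorems

namespace Quant

open Finset

namespace LawDec

set_option maxHeartbeats 4000000 in
set_option maxRecDepth 100000 in
/-- cell `LL_LL` of the top-flipped light–light piece: the capacity inequality with the cell's closed forms. -/
theorem tfpCellS_LL_LL (x p q P' : ℝ) (hx0 : 0 < x) (_hx1 : x < 1) (hp0 : 0 < p) (hpx : p < x) (hq0 : 0 < q) (hqx : q < x) (hPp : p < P') (_hr1 : q ≤ P' - p) (_hxS : 1 ≤ x ^ 3 + x ^ 2 + 3 * x) (_hx3 : x ≤ 1 / 3) (hPx : P' ≤ x) (hQx : q * P' ≤ x * (P' - p)) (_hP2 : P' ≤ 2) (_hQ2 : q * P' ≤ 2 * (P' - p)) :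
    x / (1 - x) * ((1 - (x ^ 2 + (1 - x) * p)) * (1 - (x ^ 2 + (1 - x) * q))) ≤
      x / (1 - x) * ((1 - (x ^ 2 + (1 - x) * P')) / (x ^ 2 + (1 - x) * P')) * ((x ^ 2 + (1 - x) * p) * (1 - (x ^ 2 + (1 - x) * q))) + x / (1 - x) * ((1 - (x ^ 2 + (1 - x) * (q * P' / (P' - p)))) / (x ^ 2 + (1 - x) * (q * P' / (P' - p)))) * ((1 - (x ^ 2 + (1 - x) * p)) * (x ^ 2 + (1 - x) * q)) + (x ^ 2 + (1 - x) * p) * (x ^ 2 + (1 - x) * q) := by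
  have h1x : 0 < 1 - x := by linarith
  have g0 : 0 ≤ x := hx0.le
  have g1 : 0 ≤ 1 - x := by linarith
  have g2 : 0 ≤ p := hp0.le
  have g3 : 0 ≤ x - p := by linarith
  have g4 : 0 ≤ q := hq0.le
  have g5 : 0 ≤ x - q := by linarith
  have g6 : 0 ≤ P' - p := by linarith
  have g8 : 0 ≤ x - P' := by linarith
  have g9 : 0 ≤ x * (P' - p) - q * P' := by linarith
  have key := tfpPoly_LL_LL x p q P' g0 g1 g2 g3 g4 g5 g6 g8 g9
  have hd0 : 0 < x ^ 2 + (1 - x) * P' := add_pos_of_pos_of_nonneg (pow_pos hx0 2) (mul_nonneg h1x.le (by linarith))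
  have hd1 : 0 < x ^ 2 * (P' - p) + (1 - x) * q * P' := add_pos_of_pos_of_nonneg (mul_pos (pow_pos hx0 2) (by linarith)) (mul_nonneg (mul_nonneg h1x.le (by linarith)) (by linarith))
  have hne1 : (1:ℝ) - x ≠ 0 := h1x.ne'
  have hPp' : 0 < P' - p := by linarith
  have hneA : P' - p ≠ 0 := hPp'.ne'
  have hP0 : 0 < P' := by linarith
  have hneP : P' ≠ 0 := hP0.ne'
  have hq0' : 0 < q := by linarith
  have hneq : q ≠ 0 := hq0'.ne'
  have hgP : 0 < x ^ 2 + (1 - x) * P' := add_pos_of_pos_of_nonneg (pow_pos hx0 2) (mul_nonneg h1x.le hP0.le)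
  have hnegP : x ^ 2 + (1 - x) * P' ≠ 0 := hgP.ne'
  have hQv0 : 0 < q * P' / (P' - p) := div_pos (mul_pos hq0' hP0) hPp'
  have hneQv : q * P' / (P' - p) ≠ 0 := hQv0.ne'
  have hneqP : q * P' ≠ 0 := (mul_pos hq0' hP0).ne'
  have hgQ : 0 < x ^ 2 + (1 - x) * (q * P' / (P' - p)) := add_pos_of_pos_of_nonneg (pow_pos hx0 2) (mul_nonneg h1x.le hQv0.le)
  have hnegQ : x ^ 2 + (1 - x) * (q * P' / (P' - p)) ≠ 0 := hgQ.ne'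
  rw [← sub_nonneg]
  have hden : 0 < (x ^ 2 + (1 - x) * P') * (x ^ 2 * (P' - p) + (1 - x) * q * P') := (mul_pos hd0 hd1)
  have e : (x / (1 - x) * ((1 - (x ^ 2 + (1 - x) * P')) / (x ^ 2 + (1 - x) * P')) * ((x ^ 2 + (1 - x) * p) * (1 - (x ^ 2 + (1 - x) * q))) + x / (1 - x) * ((1 - (x ^ 2 + (1 - x) * (q * P' / (P' - p)))) / (x ^ 2 + (1 - x) * (q * P' / (P' - p)))) * ((1 - (x ^ 2 + (1 - x) * p)) * (x ^ 2 + (1 - x) * q)) + (x ^ 2 + (1 - x) * p) * (x ^ 2 + (1 - x) * q) - x / (1 - x) * ((1 - (x ^ 2 + (1 - x) * p)) * (1 - (x ^ 2 + (1 - x) * q)))) * ((x ^ 2 + (1 - x) * P') * (x ^ 2 * (P' - p) + (1 - x) * q * P'))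
      = (-x ^ 3 * p * q ^ 2 * P' ^ 2 + x ^ 4 * q ^ 2 * P' ^ 2 + 2 * x ^ 4 * p * q * P' ^ 2 + x ^ 4 * p * q ^ 2 * P' - x ^ 4 * p ^ 2 * q * P' - 2 * x ^ 5 * q * P' ^ 2 - x ^ 5 * q ^ 2 * P' - x ^ 5 * p * P' ^ 2 - x ^ 5 * p * q * P' + x ^ 5 * p ^ 2 * P' + x ^ 5 * p ^ 2 * q + x ^ 6 * P' ^ 2 + 2 * x ^ 6 * q * P' - x ^ 6 * p * q - x ^ 6 * p ^ 2 - x ^ 7 * P' + x ^ 7 * p + 3 * x ^ 2 * p * q ^ 2 * P' ^ 2 - 2 * x ^ 3 * q ^ 2 * P' ^ 2 - 5 * x ^ 3 * p * q * P' ^ 2 - 3 * x ^ 3 * p * q ^ 2 * P' + 3 * x ^ 3 * p ^ 2 * q * P' + 3 * x ^ 4 * q * P' ^ 2 + 2 * x ^ 4 * q ^ 2 * P' + 2 * x ^ 4 * p * P' ^ 2 + 3 * x ^ 4 * p * q * P' - 2 * x ^ 4 * p ^ 2 * P' - 3 * x ^ 4 * p ^ 2 * q - x ^ 5 * P' ^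 2 - 3 * x ^ 5 * q * P' - x ^ 5 * p * P' + 2 * x ^ 5 * p * q + 2 * x ^ 5 * p ^ 2 + x ^ 6 * P' - x ^ 6 * p - 3 * x * p * q ^ 2 * P' ^ 2 + x ^ 2 * q ^ 2 * P' ^ 2 + 4 * x ^ 2 * p * q * P' ^ 2 + 3 * x ^ 2 * p * q ^ 2 * P' - 3 * x ^ 2 * p ^ 2 * q * P' - x ^ 3 * q * P' ^ 2 - x ^ 3 * q ^ 2 * P' - x ^ 3 * p * P' ^ 2 - 2 * x ^ 3 * p * q * P' + x ^ 3 * p ^ 2 * P' + 2 * x ^ 3 * p ^ 2 * q + x ^ 5 * P' - x ^ 5 * p + p * q ^ 2 * P' ^ 2 - x * p * q * P' ^ 2 - x * p * q ^ 2 * P' + x * p ^ 2 * q * P' + x ^ 3 * q * P' + x ^ 3 * p * P' - x ^ 3 * p * q - x ^ 3 * p ^ 2) := by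
    field_simp
    ring
  rw [eq_div_of_mul_eq hden.ne' e]
  apply div_nonneg _ hden.le
  exact key

set_option maxHeartbeats 4000000 in
set_option maxRecDepth 100000 in
/-- cell `LL_HL` of the top-flipped light–light piece: the capacity inequality with the cell's closed forms. -/
theorem tfpCellS_LL_HL (x p q P' : ℝ) (hx0 : 0 < x) (hx1 : x < 1) (hp0 : 0 < p) (hpx : p < x) (hq0 : 0 < q) (hqx : q < x) (hPp : p < P') (hr1 : q ≤ P' - p) (hxS : 1 ≤ x ^ 3 + x ^ 2 + 3 * x) (hx3 : x ≤ 1 / 3) (hxP : x ≤ P') (hP1 : P' < 1) (hQx : q * P' ≤ x * (P' - p)) (_hP2 : P' ≤ 2) (_hQ2 : q * P' ≤ 2 * (P' - p)) :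
    x / (1 - x) * ((1 - (x ^ 2 + (1 - x) * p)) * (1 - (x ^ 2 + (1 - x) * q))) ≤
      x / (1 - x) * ((1 - P') / P') * ((x ^ 2 + (1 - x) * p) * (1 - (x ^ 2 + (1 - x) * q))) + x / (1 - x) * ((1 - (x ^ 2 + (1 - x) * (q * P' / (P' - p)))) / (x ^ 2 + (1 - x) * (q * P' / (P' - p)))) * ((1 - (x ^ 2 + (1 - x) * p)) * (x ^ 2 + (1 - x) * q)) + (x ^ 2 + (1 - x) * p) * (x ^ 2 + (1 - x) * q) := by
  have h1x : 0 < 1 - x := by linarith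
  have key := tfpPolyS_LL_HL x p q P' hx0 hx1 hp0 hpx hq0 hqx hPp hr1 hxS hx3 hxP hP1 hQx
  have hd0 : 0 < P' := by linarith
  have hd1 : 0 < x ^ 2 * (P' - p) + (1 - x) * q * P' := add_pos_of_pos_of_nonneg (mul_pos (pow_pos hx0 2) (by linarith)) (mul_nonneg (mul_nonneg h1x.le (by linarith)) (by linarith))
  have hne1 : (1:ℝ) - x ≠ 0 := h1x.ne'
  have hPp' : 0 < P' - p := by linarith
  have hneA : P' - p ≠ 0 := hPp'.ne'
  have hP0 : 0 < P' := by linarith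
  have hneP : P' ≠ 0 := hP0.ne'
  have hq0' : 0 < q := by linarith
  have hneq : q ≠ 0 := hq0'.ne'
  have hQv0 : 0 < q * P' / (P' - p) := div_pos (mul_pos hq0' hP0) hPp'
  have hneQv : q * P' / (P' - p) ≠ 0 := hQv0.ne'
  have hneqP : q * P' ≠ 0 := (mul_pos hq0' hP0).ne'
  have hgQ : 0 < x ^ 2 + (1 - x) * (q * P' / (P' - p)) := add_pos_of_pos_of_nonneg (pow_pos hx0 2) (mul_nonneg h1x.le hQv0.le)
  have hnegQ : x ^ 2 + (1 - x) * (q * P' / (P' - p)) ≠ 0 := hgQ.ne'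
  rw [← sub_nonneg]
  have hden : 0 < (P') * (x ^ 2 * (P' - p) + (1 - x) * q * P') := (mul_pos hd0 hd1)
  have e : (x / (1 - x) * ((1 - P') / P') * ((x ^ 2 + (1 - x) * p) * (1 - (x ^ 2 + (1 - x) * q))) + x / (1 - x) * ((1 - (x ^ 2 + (1 - x) * (q * P' / (P' - p)))) / (x ^ 2 + (1 - x) * (q * P' / (P' - p)))) * ((1 - (x ^ 2 + (1 - x) * p)) * (x ^ 2 + (1 - x) * q)) + (x ^ 2 + (1 - x) * p) * (x ^ 2 + (1 - x) * q) - x / (1 - x) * ((1 - (x ^ 2 + (1 - x) * p)) * (1 - (x ^ 2 + (1 - x) * q)))) * ((P') * (x ^ 2 * (P' - p) + (1 - x) * q * P'))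
      = (x ^ 2 * p * q ^ 2 * P' ^ 2 - x ^ 3 * q ^ 2 * P' ^ 2 - 2 * x ^ 3 * p * q * P' ^ 2 - x ^ 3 * p * q ^ 2 * P' + x ^ 3 * p ^ 2 * q * P' + 2 * x ^ 4 * q * P' ^ 2 + x ^ 4 * q ^ 2 * P' + x ^ 4 * p * P' ^ 2 + x ^ 4 * p * q * P' - x ^ 4 * p ^ 2 * P' - x ^ 4 * p ^ 2 * q - x ^ 5 * P' ^ 2 - 2 * x ^ 5 * q * P' + x ^ 5 * p * q + x ^ 5 * p ^ 2 + x ^ 6 * P' - x ^ 6 * p - 2 * x * p * q ^ 2 * P' ^ 2 + x ^ 2 * q ^ 2 * P' ^ 2 + 3 * x ^ 2 * p * q * P' ^ 2 + 2 * x ^ 2 * p * q ^ 2 * P' - 2 * x ^ 2 * p ^ 2 * q * P' - x ^ 3 * q * P' ^ 2 - x ^ 3 * q ^ 2 * P' - x ^ 3 * p * P' ^ 2 - x ^ 3 * p * q * P' + x ^ 3 * p ^ 2 * P' + x ^ 3 * p ^ 2 * q + x ^ 5 * P' - x ^ 5 * p + p * q ^ 2 * P' ^ 2 - x * p * q * P'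 ^ 2 - x * p * q ^ 2 * P' + x * p ^ 2 * q * P' - x ^ 2 * p * q * P' + x ^ 3 * q * P' + x ^ 3 * p * P' - x ^ 3 * p ^ 2) := by
    field_simp
    ring
  rw [eq_div_of_mul_eq hden.ne' e]
  apply div_nonneg _ hden.le
  exact key

set_option maxHeartbeats 4000000 in
set_option maxRecDepth 100000 in
/-- cell `LL_HH` of the top-flipped light–light piece: the capacity inequality with the cell's closed forms. -/
theorem tfpCellS_LL_HH (x p q P' : ℝ) (hx0 : 0 < x) (_hx1 : x < 1) (hp0 : 0 < p) (hpx : p < x) (hq0 : 0 < q) (hqx : q < x) (hPp : p < P') (_hr1 : q ≤ P' - p) (_hxS : 1 ≤ x ^ 3 + x ^ 2 + 3 * x) (_hx3 : x ≤ 1 / 3) (_hxP : x ≤ P') (_hP1 : P' < 1) (_hxQ : x * (P' - p) ≤ q * P') (_hQ1 : q * P' < P' - p) (_hP2 : P' ≤ 2) (_hQ2 : q * P' ≤ 2 * (P' - p)) :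
    x / (1 - x) * ((1 - (x ^ 2 + (1 - x) * p)) * (1 - (x ^ 2 + (1 - x) * q))) ≤
      x / (1 - x) * ((1 - P') / P') * ((x ^ 2 + (1 - x) * p) * (1 - (x ^ 2 + (1 - x) * q))) + x / (1 - x) * ((1 - (q * P' / (P' - p))) / (q * P' / (P' - p))) * ((1 - (x ^ 2 + (1 - x) * p)) * (x ^ 2 + (1 - x) * q)) + (x ^ 2 + (1 - x) * p) * (x ^ 2 + (1 - x) * q) := by
  have h1x : 0 < 1 - x := by linarith
  have g0 : 0 ≤ x := hx0.le
  have g1 : 0 ≤ 1 - x := by linarith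
  have g2 : 0 ≤ p := hp0.le
  have g3 : 0 ≤ x - p := by linarith
  have g5 : 0 ≤ x - q := by linarith
  have key := tfpPoly_LL_HH x p q g0 g1 g2 g3 g5
  have hm0 : 0 < x * (P' - p) - q * (P' - x) := by nlinarith [mul_pos (sub_pos.2 hqx) (sub_pos.2 hPp), mul_nonneg (le_of_lt hq0) (sub_nonneg.2 (le_of_lt hpx))]
  have hd0 : 0 < q := by linarith
  have hd1 : 0 < P' := by linarith
  have hne1 : (1:ℝ) - x ≠ 0 := h1x.ne'
  have hPp' : 0 < P' - p := by linarith
  have hneA : P' - p ≠ 0 := hPp'.ne'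
  have hP0 : 0 < P' := by linarith
  have hneP : P' ≠ 0 := hP0.ne'
  have hq0' : 0 < q := by linarith
  have hneq : q ≠ 0 := hq0'.ne'
  have hQv0 : 0 < q * P' / (P' - p) := div_pos (mul_pos hq0' hP0) hPp'
  have hneQv : q * P' / (P' - p) ≠ 0 := hQv0.ne'
  have hneqP : q * P' ≠ 0 := (mul_pos hq0' hP0).ne'
  rw [← sub_nonneg]
  have hden : 0 < (q) * (P') := (mul_pos hd0 hd1)
  have e : (x / (1 - x) * ((1 - P') / P') * ((x ^ 2 + (1 - x) * p) * (1 - (x ^ 2 + (1 - x) * q))) + x / (1 - x) * ((1 - (q * P' / (P' - p))) / (q * P' / (P' - p))) * ((1 - (x ^ 2 + (1 - x) * p)) * (x ^ 2 + (1 - x) * q)) + (x ^ 2 + (1 - x) * p) * (x ^ 2 + (1 - x) * q) - x / (1 - x) * ((1 - (x ^ 2 + (1 - x) * p)) * (1 - (x ^ 2 + (1 - x) * q)))) * ((q) * (P'))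
      = (x * (P' - p) - q * (P' - x)) * (x * p * q - x ^ 2 * q - x ^ 2 * p + x ^ 3 - p * q + x ^ 2) := by
    field_simp
    ring
  rw [eq_div_of_mul_eq hden.ne' e]
  apply div_nonneg _ hden.le
  exact mul_nonneg (le_of_lt hm0) key

set_option maxHeartbeats 4000000 in
set_option maxRecDepth 100000 in
/-- cell `LL_1L` of the top-flipped light–light piece: the capacity inequality with the cell's closed forms. -/
theorem tfpCellS_LL_1L (x p q Q' : ℝ) (hx0 : 0 < x) (_hx1 : x < 1) (hp0 : 0 < p) (hpx : p < x) (hq0 : 0 < q) (hqx : q < x) (hQq : q < Q') (hPge1 : Q' * (1 - p) ≤ q) (_hr1 : Q' - q ≤ p) (hxS : 1 ≤ x ^ 3 + x ^ 2 + 3 * x) (hx3 : x ≤ 1 / 3) (hQx : Q' ≤ x) (_hQ2 : Q' ≤ 2) :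
    x / (1 - x) * ((1 - (x ^ 2 + (1 - x) * p)) * (1 - (x ^ 2 + (1 - x) * q))) ≤
      0 * ((x ^ 2 + (1 - x) * p) * (1 - (x ^ 2 + (1 - x) * q))) + x / (1 - x) * ((1 - (x ^ 2 + (1 - x) * Q')) / (x ^ 2 + (1 - x) * Q')) * ((1 - (x ^ 2 + (1 - x) * p)) * (x ^ 2 + (1 - x) * q)) + (x ^ 2 + (1 - x) * p) * (x ^ 2 + (1 - x) * q) := by
  have h1x : 0 < 1 - x := by linarith
  have key : 0 ≤ -x ^ 3 * p * q * Q' + x ^ 4 * q * Q' + x ^ 4 * p * Q' + x ^ 4 * p * q - x ^ 5 * Q' - x ^ 5 * q - x ^ 5 * p + x ^ 6 + 3 * x ^ 2 * p * q * Q' - 2 * x ^ 3 * q * Q' - 2 * x ^ 3 * p * Q' - 2 * x ^ 3 * p * q + x ^ 4 * Q' + x ^ 4 * q + x ^ 4 * p - 3 * x * p * q * Q' + x ^ 2 * q * Q' + 2 * x ^ 2 * p * q + x ^ 3 * Q' - x ^ 3 * q + p * q * Q' + x * p * Q' - x * p * q - x * Q' + x * q := by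
    rcases le_total x (2 * Q') with hh | hh
    · exact tfpPolyS_LL_1L_a x p q Q' hx0.le (by linarith) hp0.le (by linarith) hq0.le (by linarith) (by linarith) (by linarith) (by linarith) (by linarith) (by linarith) (by nlinarith) (by nlinarith) (by linarith) (by linarith) (by linarith) (by linarith)
    · exact tfpPolyS_LL_1L_b x p q Q' hx0.le (by linarith) hp0.le (by linarith) hq0.le (by linarith) (by linarith) (by linarith) (by linarith) (by linarith) (by linarith) (by nlinarith) (by nlinarith) (by linarith) (by linarith) (by linarith) (by linarith)
  have hd0 : 0 < x ^ 2 + (1 - x) * Q' := add_pos_of_pos_of_nonneg (pow_pos hx0 2) (mul_nonneg h1x.le (by linarith))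
  have hne1 : (1:ℝ) - x ≠ 0 := h1x.ne'
  have hQ0 : 0 < Q' := by linarith
  have hneQ : Q' ≠ 0 := hQ0.ne'
  have hgQ : 0 < x ^ 2 + (1 - x) * Q' := add_pos_of_pos_of_nonneg (pow_pos hx0 2) (mul_nonneg h1x.le hQ0.le)
  have hnegQ : x ^ 2 + (1 - x) * Q' ≠ 0 := hgQ.ne'
  rw [← sub_nonneg]
  have hden : 0 < (x ^ 2 + (1 - x) * Q') := hd0
  have e : (0 * ((x ^ 2 + (1 - x) * p) * (1 - (x ^ 2 + (1 - x) * q))) + x / (1 - x) * ((1 - (x ^ 2 + (1 - x) * Q')) / (x ^ 2 + (1 - x) * Q')) * ((1 - (x ^ 2 + (1 - x) * p)) * (x ^ 2 + (1 - x) * q)) + (x ^ 2 + (1 - x) * p) * (x ^ 2 + (1 - x) * q) - x / (1 - x) * ((1 - (x ^ 2 + (1 - x) * p)) * (1 - (x ^ 2 + (1 - x) * q)))) * ((x ^ 2 + (1 - x) * Q'))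
      = (-x ^ 3 * p * q * Q' + x ^ 4 * q * Q' + x ^ 4 * p * Q' + x ^ 4 * p * q - x ^ 5 * Q' - x ^ 5 * q - x ^ 5 * p + x ^ 6 + 3 * x ^ 2 * p * q * Q' - 2 * x ^ 3 * q * Q' - 2 * x ^ 3 * p * Q' - 2 * x ^ 3 * p * q + x ^ 4 * Q' + x ^ 4 * q + x ^ 4 * p - 3 * x * p * q * Q' + x ^ 2 * q * Q' + 2 * x ^ 2 * p * q + x ^ 3 * Q' - x ^ 3 * q + p * q * Q' + x * p * Q' - x * p * q - x * Q' + x * q) := by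
    field_simp
    ring
  rw [eq_div_of_mul_eq hden.ne' e]
  apply div_nonneg _ hden.le
  exact key

set_option maxHeartbeats 4000000 in
set_option maxRecDepth 100000 in
/-- cell `LL_1H` of the top-flipped light–light piece: the capacity inequality with the cell's closed forms. -/
theorem tfpCellS_LL_1H (x p q Q' : ℝ) (_hx0 : 0 < x) (_hx1 : x < 1) (_hp0 : 0 < p) (hpx : p < x) (hq0 : 0 < q) (hqx : q < x) (hQq : q < Q') (hPge1 : Q' * (1 - p) ≤ q) (_hr1 : Q' - q ≤ p) (_hxS : 1 ≤ x ^ 3 + x ^ 2 + 3 * x) (_hx3 : x ≤ 1 / 3) (hxQ : x ≤ Q') (_hQ1 : Q' < 1) (_hQ2 : Q' ≤ 2) :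
    x / (1 - x) * ((1 - (x ^ 2 + (1 - x) * p)) * (1 - (x ^ 2 + (1 - x) * q))) ≤
      0 * ((x ^ 2 + (1 - x) * p) * (1 - (x ^ 2 + (1 - x) * q))) + x / (1 - x) * ((1 - Q') / Q') * ((1 - (x ^ 2 + (1 - x) * p)) * (x ^ 2 + (1 - x) * q)) + (x ^ 2 + (1 - x) * p) * (x ^ 2 + (1 - x) * q) := by
  have h1x : 0 < 1 - x := by linarith
  have key := tfpPoly_LL_1H x p q Q' _hx0.le (by linarith) (by linarith) hq0.le (by linarith) (by linarith) (by linarith) (by linarith)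
  have hd0 : 0 < Q' := by linarith
  have hne1 : (1:ℝ) - x ≠ 0 := h1x.ne'
  have hQ0 : 0 < Q' := by linarith
  have hneQ : Q' ≠ 0 := hQ0.ne'
  rw [← sub_nonneg]
  have hden : 0 < (Q') := hd0
  have e : (0 * ((x ^ 2 + (1 - x) * p) * (1 - (x ^ 2 + (1 - x) * q))) + x / (1 - x) * ((1 - Q') / Q') * ((1 - (x ^ 2 + (1 - x) * p)) * (x ^ 2 + (1 - x) * q)) + (x ^ 2 + (1 - x) * p) * (x ^ 2 + (1 - x) * q) - x / (1 - x) * ((1 - (x ^ 2 + (1 - x) * p)) * (1 - (x ^ 2 + (1 - x) * q)))) * ((Q'))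
      = (x ^ 2 * p * q * Q' - x ^ 3 * q * Q' - x ^ 3 * p * Q' + x ^ 4 * Q' - 2 * x * p * q * Q' + x ^ 2 * q * Q' + x ^ 2 * p * Q' + x ^ 2 * p * q - x ^ 3 * q - x ^ 3 * p + x ^ 4 + p * q * Q' + x * p * Q' - x * p * q - x ^ 2 * Q' + x ^ 3 - x * Q' + x * q) := by
    field_simp
    ring
  rw [eq_div_of_mul_eq hden.ne' e]
  apply div_nonneg _ hden.le
  exact key

set_option maxHeartbeats 4000000 in
set_option maxRecDepth 100000 in
/-- cell `LL_11` of the top-flipped light–light piece: the capacity inequality with the cell's closed forms. -/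
theorem tfpCellS_LL_11 (x p q Q' : ℝ) (_hx0 : 0 < x) (_hx1 : x < 1) (_hp0 : 0 < p) (hpx : p < x) (_hq0 : 0 < q) (hqx : q < x) (_hQq : q < Q') (_hPge1 : Q' * (1 - p) ≤ q) (hr1 : Q' - q ≤ p) (_hxS : 1 ≤ x ^ 3 + x ^ 2 + 3 * x) (_hx3 : x ≤ 1 / 3) (h1Q : 1 ≤ Q') (_hQ2 : Q' ≤ 2) :
    x / (1 - x) * ((1 - (x ^ 2 + (1 - x) * p)) * (1 - (x ^ 2 + (1 - x) * q))) ≤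
      0 * ((x ^ 2 + (1 - x) * p) * (1 - (x ^ 2 + (1 - x) * q))) + 0 * ((1 - (x ^ 2 + (1 - x) * p)) * (x ^ 2 + (1 - x) * q)) + (x ^ 2 + (1 - x) * p) * (x ^ 2 + (1 - x) * q) := by
  have h1x : 0 < 1 - x := by linarith
  have key := tfpPoly_LL_11 x p q Q' _hx0.le _hp0.le (by linarith) _hq0.le (by linarith) (by linarith) (by linarith)
  have hne1 : (1:ℝ) - x ≠ 0 := h1x.ne'
  have hQ0 : 0 < Q' := by linarith
  have hneQ : Q' ≠ 0 := hQ0.ne'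
  rw [← sub_nonneg]
  have e : 0 * ((x ^ 2 + (1 - x) * p) * (1 - (x ^ 2 + (1 - x) * q))) + 0 * ((1 - (x ^ 2 + (1 - x) * p)) * (x ^ 2 + (1 - x) * q)) + (x ^ 2 + (1 - x) * p) * (x ^ 2 + (1 - x) * q) - x / (1 - x) * ((1 - (x ^ 2 + (1 - x) * p)) * (1 - (x ^ 2 + (1 - x) * q)))
      = (2 * x ^ 2 * p * q - 2 * x ^ 3 * q - 2 * x ^ 3 * p + 2 * x ^ 4 - 3 * x * p * q + x ^ 2 * q + x ^ 2 * p + x ^ 3 + p * q + x * q + x * p - x ^ 2 - x) := by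
    field_simp
    ring
  rw [e]
  exact key

end LawDec

end Quant

end Summit.CriticalPhenomena.PercolationContinuityZ3.Theorems
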